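import Literature.Computability.QuantumComplexity.GadgetInstances
import HarnessLib

/-!
# Data-dependent thresholds: entries encoded by a field of the label, and the local entry bound

Topic `Literature/Computability/QuantumComplexity`, a sequel of `GadgetInstances.lean`. There the sign
predicates of the AJL rotation gadget encode CONSTANT entries (`EncodesEntry k p v`: for every value of
the high bits the threshold count is `2^k(1 − v)/2 ± 1`). In the Grover–Rudolph stage of Regev's
quantum sampler (Regev 2009, Lemma 3.14 via Lemma 3.12; Grover–Rudolph 2002) the rotation at level `j`
depends on the prefix: its cosine `A/2^k` is first COMPUTED (reversibly, garbage-free) into a register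
of the label, and the gadget's predicate compares the averaging field with that register. This file
supplies the corresponding local notions:

* `SLP.EncodesEntryAt k p v rest` — the encoding holds for the four high parts `hiOf bb zt rest` of a
  fixed label (`encodesEntryAt_of_encodesEntry`), and **`SLP.rotSign_entry_bound_at`** — the entry
  bound of `rotSign_entry_bound` under these local hypotheses (same proof);
* `SLP.ltFieldB k o` — the threshold `n < F` where `F` is the `k`-bit field of `rest` at offset `o`
  (bits `k+2+o …` of the gadget input; `fieldVal`, `ltFieldB_eval`, `ltFieldB_ok`, `ltFieldB_maxBnd`,
  `ltFieldB_readsHigh`-free: it reads the low field by design); **`SLP.encodesEntryAt_ltFieldB`** and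
  `encodesEntryAt_not_ltFieldB`: it encodes `1 − 2F/2^k` (resp. its negative) EXACTLY at `rest`;
* `SLP.grRotB k oA oS` — the sign predicate of the Grover–Rudolph level rotation (always on: control
  `trueB (k+2)`; diagonal from the field `A` at `oA`, off-diagonal from the field `S` at `oS`) and
  **`SLP.grRot_entry_bound`** — for ANY real block `G = [[c, −s], [s, c]]`, the gadget quantity is within
  `2/2^k + (|ã − c| + |s̃ − s|)` of the entry of `−G`, where `ã = 1 − 2F_A/2^k`, `s̃ = 1 − 2F_S/2^k`.

Everything here is proved; definitions have bodies; no named fact is introduced.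

## References

* L. Grover, T. Rudolph, *Creating superpositions that correspond to efficiently integrable probability
  distributions*, arXiv:quant-ph/0208112 (2002), eq. (4)–(5) [GroverRudolph2002].
* O. Regev, *On lattices, learning with errors, random linear codes, and cryptography*, J. ACM 56
  (2009), art. 34, Lemma 3.12 (proof), §2 p. 11 [Regev2009].
* D. Aharonov, V. Jones, Z. Landau, Algorithmica 55 (2009), Claim 4.1, Thm. 4.3 [AharonovJonesLandau2009].
-/

noncomputable section

namespace Literature.Computability.QuantumComplexity

namespace SLP

open Real Finset

/-! ### Local encodings -/

/-- **`p` encodes the entry `v` at the label `rest`**: the count condition of `EncodesEntry` for the four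
high parts `hiOf bb zt rest`. [folklore] -/
def EncodesEntryAt (k : ℕ) (p : BExpr) (v : ℝ) (rest : ℕ) : Prop :=
  ∀ bb zt : Bool, |(1 - 2 * (cnt k p (hiOf bb zt rest) : ℝ) / 2 ^ k) - v| ≤ 2 / 2 ^ k

/-- A global encoding is a local one. [folklore] -/
theorem encodesEntryAt_of_encodesEntry {k : ℕ} {p : BExpr} {v : ℝ} (h : EncodesEntry k p v) (rest : ℕ) : EncodesEntryAt k p v rest :=
  fun _ _ => h _

/-- **The local entry bound of a rotation gadget** (the proof of `rotSign_entry_bound`, which uses the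
encodings only at the four high parts of the label). [cite: AharonovJonesLandau2009, Claim 4.1 and Thm. 4.3] -/
theorem rotSign_entry_bound_at (k : ℕ) {ctl pd p10 p01 : BExpr} (hctl : ctl.ReadsHigh (k + 2)) {d g10 g01 : ℝ} {rest : ℕ}
    (hd : EncodesEntryAt k pd (-d) rest) (h10 : EncodesEntryAt k p10 (-g10) rest) (h01 : EncodesEntryAt k p01 (-g01) rest)
    (M : Matrix (Cryptography.QReg 1) (Cryptography.QReg 1) ℂ)
    (hM : ∀ x y : Cryptography.QReg 1, M x y = if x 0 = y 0 then (d : ℂ) else if x 0 = true then (g10 : ℂ) else (g01 : ℂ))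
    (bb zt : Bool) :
    ‖((1 : ℂ) - 2 * (((Finset.range (2 ^ k)).filter fun n =>
        (rotSignB k ctl pd p10 p01).eval (2 ^ k * hiOf bb zt rest + n) = true).card : ℂ) / 2 ^ k) -
      (-(if ctl.eval (2 ^ (k + 2) * rest) then M else (1 : Matrix (Cryptography.QReg 1) (Cryptography.QReg 1) ℂ))
        (fun _ => bb ^^ zt) (fun _ => zt))‖ ≤ 2 / 2 ^ k := by
  set C := ctl.eval (2 ^ (k + 2) * rest) with hC
  have hCn : ∀ n, n < 2 ^ k → ctl.eval (2 ^ k * hiOf bb zt rest + n) = C := by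
    intro n hn
    obtain ⟨e, hlt⟩ := split_hiOf k bb zt rest hn
    rw [e, ctl.eval_eq_of_readsHigh hctl hlt]
  -- the predicate selected by the three bits
  set q : BExpr := if C then (if bb then (if zt then p01 else p10) else pd) else (if bb then thr0B k else trueB k) with hq
  have hsel : ∀ n, n < 2 ^ k → (rotSignB k ctl pd p10 p01).eval (2 ^ k * hiOf bb zt rest + n) = q.eval (2 ^ k * hiOf bb zt rest + n) := by
    intro n hn
    obtain ⟨hb, ht⟩ := testBit_hiOf k bb zt rest hn
    simp only [rotSignB, iteB_eval, bitB_eval, hb, ht, hCn n hn, hq]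
    cases C <;> cases bb <;> cases zt <;> rfl
  have hcnt : (((Finset.range (2 ^ k)).filter fun n => (rotSignB k ctl pd p10 p01).eval (2 ^ k * hiOf bb zt rest + n) = true).card) =
      cnt k q (hiOf bb zt rest) := by
    unfold cnt; exact congrArg _ (Finset.filter_congr fun n hn => by rw [hsel n (Finset.mem_range.1 hn)])
  rw [hcnt]
  -- the selected entry
  set v : ℝ := if C then (if bb then (if zt then -g01 else -g10) else -d) else (if bb then 0 else -1) with hv
  have henc : |(1 - 2 * (cnt k q (hiOf bb zt rest) : ℝ) / 2 ^ k) - v| ≤ 2 / 2 ^ k := by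
    rw [hq, hv]
    cases C <;> cases bb <;> cases zt <;> simp only [if_true, if_false, Bool.false_eq_true]
    exacts [encodesEntry_trueB k k _, encodesEntry_trueB k k _, encodesEntry_thr0B k _, encodesEntry_thr0B k _,
      hd false false, hd false true, h10 true false, h01 true true]
  have htarget : (-(if C then M else (1 : Matrix (Cryptography.QReg 1) (Cryptography.QReg 1) ℂ)) (fun _ => bb ^^ zt) (fun _ => zt)) = (v : ℂ) := by
    rw [hv]
    have hTF : ((fun _ => true : Cryptography.QReg 1) = fun _ => false) ↔ False :=
      ⟨fun e => by have := congrFun e 0; simp at this, False.elim⟩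
    have hFT : ((fun _ => false : Cryptography.QReg 1) = fun _ => true) ↔ False :=
      ⟨fun e => by have := congrFun e 0; simp at this, False.elim⟩
    cases C <;> cases bb <;> cases zt <;>
      simp [Matrix.one_apply, hM, hTF, hFT]
  rw [htarget]
  have e : ((1 : ℂ) - 2 * ((cnt k q (hiOf bb zt rest) : ℕ) : ℂ) / 2 ^ k) - (v : ℂ) =
      (((1 - 2 * (cnt k q (hiOf bb zt rest) : ℝ) / 2 ^ k) - v : ℝ) : ℂ) := by push_cast; ring
  rw [e, Complex.norm_real, Real.norm_eq_abs]
  exact henc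

/-! ### Thresholds given by a field of the label -/

/-- **The `k`-bit field of `rest` at offset `o`.** [folklore] -/
def fieldVal (k o rest : ℕ) : ℕ := rest / 2 ^ o % 2 ^ k

/-- The field is below `2^k`. [folklore] -/
theorem fieldVal_lt (k o rest : ℕ) : fieldVal k o rest < 2 ^ k := Nat.mod_lt _ (Nat.two_pow_pos k)

/-- **The threshold `n < F`**, `F` the field at bits `k+2+o, …, k+2+o+k−1` of the gadget input. [folklore] -/
def ltFieldB (k o : ℕ) : BExpr := .lt (aE k) (.fld (k + 2 + o) k)

/-- The field read on a gadget input `2^k·hiOf bb zt rest + n` is `fieldVal k o rest`. [folklore] -/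
theorem fld_eval_gadgetInput (k o : ℕ) (bb zt : Bool) (rest : ℕ) {n : ℕ} (hn : n < 2 ^ k) :
    (AExpr.fld (k + 2 + o) k).eval (2 ^ k * hiOf bb zt rest + n) = fieldVal k o rest := by
  obtain ⟨e, hlt⟩ := split_hiOf k bb zt rest hn
  show (2 ^ k * hiOf bb zt rest + n) / 2 ^ (k + 2 + o) % 2 ^ k = rest / 2 ^ o % 2 ^ k
  rw [e, pow_add 2 (k + 2) o, ← Nat.div_div_eq_div_mul, Nat.add_comm (2 ^ (k + 2) * rest), Nat.add_mul_div_left _ _ (Nat.two_pow_pos _),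
    Nat.div_eq_of_lt hlt, zero_add]

/-- Semantics of `ltFieldB` on a gadget input. [folklore] -/
theorem ltFieldB_eval (k o : ℕ) (bb zt : Bool) (rest : ℕ) {n : ℕ} (hn : n < 2 ^ k) :
    (ltFieldB k o).eval (2 ^ k * hiOf bb zt rest + n) = decide (n < fieldVal k o rest) := by
  rw [ltFieldB, BExpr.eval, fld_eval_gadgetInput k o bb zt rest hn]
  congr 2
  show (2 ^ k * hiOf bb zt rest + n) / 2 ^ 0 % 2 ^ k = n
  rw [pow_zero, Nat.div_one, mod_field hn]

/-- Side conditions of `ltFieldB`. [folklore] -/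
theorem ltFieldB_ok {Wd kIn k o : ℕ} (hk : k + 2 + o + k ≤ kIn) (hkW : k ≤ Wd) : (ltFieldB k o).OK Wd kIn :=
  ⟨⟨by simp only [zero_add]; omega, hkW⟩, ⟨hk, hkW⟩⟩

/-- Intermediate bound of `ltFieldB`. [folklore] -/
theorem ltFieldB_maxBnd (k o : ℕ) : (ltFieldB k o).maxBnd = 2 ^ k := by
  simp [ltFieldB, BExpr.maxBnd, aE, AExpr.maxBnd, AExpr.bnd]

/-- The count of `ltFieldB` at a gadget label is the field value. [folklore] -/
theorem cnt_ltFieldB (k o : ℕ) (bb zt : Bool) (rest : ℕ) : cnt k (ltFieldB k o) (hiOf bb zt rest) = fieldVal k o rest := by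
  unfold cnt
  have hF := fieldVal_lt k o rest
  rw [show ((Finset.range (2 ^ k)).filter fun n => (ltFieldB k o).eval (2 ^ k * hiOf bb zt rest + n) = true) = Finset.range (fieldVal k o rest) from ?_]
  · exact Finset.card_range _
  ext n
  simp only [Finset.mem_filter, Finset.mem_range]
  constructor
  · rintro ⟨hn, h⟩
    rw [ltFieldB_eval k o bb zt rest hn, decide_eq_true_eq] at h
    exact h
  · intro h
    refine ⟨h.trans hF, ?_⟩
    rw [ltFieldB_eval k o bb zt rest (h.trans hF), decide_eq_true_eq]
    exact h

/-- The count of the negated threshold is the complement. [folklore] -/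
theorem cnt_not_ltFieldB (k o : ℕ) (bb zt : Bool) (rest : ℕ) : cnt k (.not (ltFieldB k o)) (hiOf bb zt rest) = 2 ^ k - fieldVal k o rest := by
  unfold cnt
  have hF := fieldVal_lt k o rest
  rw [show ((Finset.range (2 ^ k)).filter fun n => (BExpr.not (ltFieldB k o)).eval (2 ^ k * hiOf bb zt rest + n) = true) =
      (Finset.range (2 ^ k)).filter (fun n => ¬ n < fieldVal k o rest) from ?_]
  · rw [Finset.filter_not, Finset.card_sdiff_of_subset (Finset.filter_subset _ _), Finset.card_range]
    congr 1
    rw [show ((Finset.range (2 ^ k)).filter fun n => n < fieldVal k o rest) = Finset.range (fieldVal k o rest) from ?_]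
    · exact Finset.card_range _
    ext n; simp only [Finset.mem_filter, Finset.mem_range]; constructor
    · exact fun h => h.2
    · exact fun h => ⟨h.trans hF, h⟩
  ext n
  simp only [Finset.mem_filter, Finset.mem_range, and_congr_right_iff]
  intro hn
  rw [BExpr.eval, ltFieldB_eval k o bb zt rest hn, Bool.not_eq_true', decide_eq_false_iff_not]

/-- **A field threshold encodes `1 − 2F/2^k` at its label** (exactly). [folklore] -/
theorem encodesEntryAt_ltFieldB (k o rest : ℕ) : EncodesEntryAt k (ltFieldB k o) (1 - 2 * (fieldVal k o rest : ℝ) / 2 ^ k) rest := by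
  intro bb zt
  rw [cnt_ltFieldB, sub_self, abs_zero]; positivity

/-- **The negated field threshold encodes `−(1 − 2F/2^k)`.** [folklore] -/
theorem encodesEntryAt_not_ltFieldB (k o rest : ℕ) :
    EncodesEntryAt k (.not (ltFieldB k o)) (-(1 - 2 * (fieldVal k o rest : ℝ) / 2 ^ k)) rest := by
  intro bb zt
  rw [cnt_not_ltFieldB, Nat.cast_sub (fieldVal_lt k o rest).le]
  push_cast
  rw [show (1 - 2 * ((2 : ℝ) ^ k - (fieldVal k o rest : ℝ)) / 2 ^ k) - -(1 - 2 * (fieldVal k o rest : ℝ) / 2 ^ k) = 0 by field_simp; ring,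
    abs_zero]
  positivity

/-! ### The Grover–Rudolph level rotation -/

/-- **The sign predicate of the Grover–Rudolph rotation**: always on (`trueB (k+2)`), diagonal entry from
the field `A` at offset `oA` (encoding `−ã`: the negated threshold), lower-left from the field `S` at
`oS` (encoding `−s̃`), upper-right its negative (encoding `s̃`). [cite: GroverRudolph2002, eq. (5)] -/
def grRotB (k oA oS : ℕ) : BExpr := rotSignB k (trueB (k + 2)) (.not (ltFieldB k oA)) (.not (ltFieldB k oS)) (ltFieldB k oS)

/-- `trueB j` reads high for `j ≥ k`. [folklore] -/
theorem trueB_readsHigh {k j : ℕ} (h : k ≤ j) : (trueB j).ReadsHigh k := ⟨bitB_readsHigh h, bitB_readsHigh h⟩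

/-- **The entry bound of the Grover–Rudolph rotation gadget.** For ANY real block
`G = [[c, −s], [s, c]]` (rows = output bit), with `ã = 1 − 2F_A/2^k`, `s̃ = 1 − 2F_S/2^k` read off the label:
the gadget quantity is within `2/2^k + (|ã − c| + |s̃ − s|)` of the entry of `−G`.
[cite: GroverRudolph2002, eq. (5)] [cite: AharonovJonesLandau2009, Thm. 4.3] -/
theorem grRot_entry_bound (k oA oS : ℕ) (c s : ℝ) (G : Matrix (Cryptography.QReg 1) (Cryptography.QReg 1) ℂ)
    (hG : ∀ x y : Cryptography.QReg 1, G x y = if x 0 = y 0 then (c : ℂ) else if x 0 = true then (s : ℂ) else (-s : ℂ))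
    (rest : ℕ) (bb zt : Bool) :
    ‖((1 : ℂ) - 2 * (((Finset.range (2 ^ k)).filter fun n =>
        (grRotB k oA oS).eval (2 ^ k * hiOf bb zt rest + n) = true).card : ℂ) / 2 ^ k) - (-G) (fun _ => bb ^^ zt) (fun _ => zt)‖ ≤
      2 / 2 ^ k + (|(1 - 2 * (fieldVal k oA rest : ℝ) / 2 ^ k) - c| + |(1 - 2 * (fieldVal k oS rest : ℝ) / 2 ^ k) - s|) := by
  set a' : ℝ := 1 - 2 * (fieldVal k oA rest : ℝ) / 2 ^ k with ha'
  set s' : ℝ := 1 - 2 * (fieldVal k oS rest : ℝ) / 2 ^ k with hs'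
  -- the encoded block
  set M : Matrix (Cryptography.QReg 1) (Cryptography.QReg 1) ℂ :=
    Matrix.of fun x y : Cryptography.QReg 1 => if x 0 = y 0 then (a' : ℂ) else if x 0 = true then (s' : ℂ) else ((-s' : ℝ) : ℂ) with hMdef
  have hM : ∀ x y : Cryptography.QReg 1, M x y = if x 0 = y 0 then (a' : ℂ) else if x 0 = true then (s' : ℂ) else ((-s' : ℝ) : ℂ) :=
    fun x y => rfl
  have hd : EncodesEntryAt k (.not (ltFieldB k oA)) (-a') rest := encodesEntryAt_not_ltFieldB k oA rest
  have h10 : EncodesEntryAt k (.not (ltFieldB k oS)) (-s') rest := encodesEntryAt_not_ltFieldB k oS rest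
  have h01 : EncodesEntryAt k (ltFieldB k oS) (-(-s')) rest := by rw [neg_neg]; exact encodesEntryAt_ltFieldB k oS rest
  have key := rotSign_entry_bound_at k (trueB_readsHigh le_rfl) hd h10 h01 M hM bb zt
  rw [trueB_eval, if_pos rfl, ← grRotB] at key
  -- from `M` to `G`
  set X : ℂ := (1 : ℂ) - 2 * (((Finset.range (2 ^ k)).filter fun n =>
        (grRotB k oA oS).eval (2 ^ k * hiOf bb zt rest + n) = true).card : ℂ) / 2 ^ k with hX
  have hMG : ‖(-M) (fun _ => bb ^^ zt) (fun _ => zt) - (-G) (fun _ => bb ^^ zt) (fun _ => zt)‖ ≤ |a' - c| + |s' - s| := by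
    rw [Matrix.neg_apply, Matrix.neg_apply, neg_sub_neg, hG, hM]
    cases bb <;> cases zt <;> simp only [Bool.xor_false, Bool.xor_true, Bool.not_false, Bool.not_true,
      if_true, if_false, Bool.false_eq_true, Bool.true_eq_false]
    · rw [← Complex.ofReal_sub, Complex.norm_real, Real.norm_eq_abs, abs_sub_comm]
      exact le_add_of_nonneg_right (abs_nonneg _)
    · rw [← Complex.ofReal_sub, Complex.norm_real, Real.norm_eq_abs, abs_sub_comm]
      exact le_add_of_nonneg_right (abs_nonneg _)
    · rw [← Complex.ofReal_sub, Complex.norm_real, Real.norm_eq_abs, abs_sub_comm]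
      exact le_add_of_nonneg_left (abs_nonneg _)
    · rw [Complex.ofReal_neg, show (-(s : ℂ) - -(s' : ℂ)) = ((s' - s : ℝ) : ℂ) by push_cast; ring, Complex.norm_real, Real.norm_eq_abs]
      exact le_add_of_nonneg_left (abs_nonneg _)
  calc ‖X - (-G) (fun _ => bb ^^ zt) (fun _ => zt)‖
      ≤ ‖X - (-M) (fun _ => bb ^^ zt) (fun _ => zt)‖ + ‖(-M) (fun _ => bb ^^ zt) (fun _ => zt) - (-G) (fun _ => bb ^^ zt) (fun _ => zt)‖ :=
        norm_sub_le_norm_sub_add_norm_sub _ _ _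
    _ ≤ 2 / 2 ^ k + (|a' - c| + |s' - s|) := add_le_add key hMG

end SLP

end Literature.Computability.QuantumComplexity

end
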